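import Mathlib
import Summits.KontsevichZagierPeriods.Zeta5Search.Certificates.RayC1Window
import Summits.KontsevichZagierPeriods.Zeta5Search.Certificates.RayC1AperyRho
import HarnessLib

/-!
# S4-C1 LITE L6a — clause (E) on the C1 ray: the C1 pair is Apéry-type (cert-1 g7; port of fam-tele g15’s S4-R1 #7 `RecordRayApery`)

HONEST FRAMING: systematic search; no irrationality claim unless certified.  C1 is the cell's CALIBRATION ray
`a = (18,32,23,30,28,38,43,30)` (clause (M) only was in the tree before S4-C1; λ* = 108.2193 its certified tie; every γ < 1).
An algebraic statement about the C1 sequences `P_n = c1P n`, `Q_n = c1Q n` (`RayC1Forms`): up to their common explicit unit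
`ρ_n = rhoOf (aC1 n)` (`c1P n = ρ_n · p̂_n`, `c1Q n = ρ_n · q̂_n`, `c1P_eq_pHatC1`, `c1Q_eq_qHatC1`) they satisfy ONE linear
recurrence of order 3 with coefficients in `ℚ[n]` and nonzero top coefficient: `aperyType_c1 : IsAperyType pHatC1 qHatC1`
(the Literature predicate of `BrownZudilin2022.CellularZetaFive`).  VERBATIM port of S4-R1 #7 (`RecordRayApery`, fam-tele g15,
read by cert-1 g7 06:11Z) over fam-tele's C1 chain (L1–L5c: `Pgen`, `prodA`, `sA`, `sB`, `cRec`, `frame_chain`, `Dwin`,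
`Dwin_ne_of_mod` in namespace `RayC1.Generic`).  Nothing here is a statement about the size of anything or about `ζ(5)`.

Proof (the Cramer eliminant of the window, fam-tele g14 blueprint §4 (E)).  By `RecordRayChain.frame_chain`
and `RecordRayConnection.adjugate_row_of_step`, every row `u_n` of `adj T(b_n)` obeys
`u_{n+k} = (∏_{j<k} c_{n+j}²) · u_n · A_k(n)`, `A_k(ν) = adj P̃(ν)⋯adj P̃(ν+k−1)`; so the four numbers `u_{n+k,2}`
(`k = 0..3`) are `u_n` paired with the four vectors `w_k(n) = A_k(n)e₂ ∈ ℚ³`, which are dependent with the 3×3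
minors `μ_k` as coefficients (`cramer4`), and `μ₃ = −D` is minus the window determinant (`mu3_eq`), nonzero at
`n = 1` (`RayC1Window.Dwin_ne_of_mod`, mod 193).  Clearing the chain scalars `c = sA/(det Ã·sB)` gives coefficients
`coef_k ∈ ℤ[ν]`, generic over rings and natural (`map_coefK`), whence honest polynomials `cPoly k = X·coef_k(X)`
(the factor `X` covers `n = 0`, where no chain rule is available).
-/

namespace Summit.KontsevichZagierPeriods.Zeta5Search.RayC1.Generic

open Matrix Filter Polynomial
open Summit.KontsevichZagierPeriods.Zeta5Search.WedgeDictionary (rhoOf)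
open Summit.KontsevichZagierPeriods.Zeta5Search.RayC1 (aC1 bC1 c1P c1Q c1Q_eq_adjugate c1P_eq_adjugate)
open Summit.KontsevichZagierPeriods.Zeta5Search.RecordRay.Connection (frameMat adjugate_row_of_step windowMat)
open Summit.KontsevichZagierPeriods.Zeta5Search.RecordRay.Generic (col2 rows3 cramer4 map_col2 map_rows3_det eventually_eval_ne_zero)
open Literature.NumberTheory.Irrationality.BrownZudilin2022 (IsAperyType)

/-! ### 1. The eliminant, over any commutative ring -/

section Generic

variable {R S : Type*} [CommRing R] [CommRing S] (f : R →+* S)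

/-- `A₁ = adj P̃(ν)`, `A₂ = adj P̃(ν)·adj P̃(ν+1)`, `A₃ = adj P̃(ν)·adj P̃(ν+1)·adj P̃(ν+2)`. -/
noncomputable def A1 (ν : R) : Matrix (Fin 3) (Fin 3) R := (Pgen ν).adjugate
/-- `adj Pgen(ν) · adj Pgen(ν+1)`. -/
noncomputable def A2 (ν : R) : Matrix (Fin 3) (Fin 3) R := (Pgen ν).adjugate * (Pgen (ν + 1)).adjugate
/-- `adj Pgen(ν) · adj Pgen(ν+1) · adj Pgen(ν+2)`. -/
noncomputable def A3 (ν : R) : Matrix (Fin 3) (Fin 3) R :=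
  (Pgen ν).adjugate * (Pgen (ν + 1)).adjugate * (Pgen (ν + 2)).adjugate

/-- `w₀ = e₂`, `w_k(ν) = A_k(ν) e₂`. -/
def w0 : Fin 3 → R := col2 1
/-- Column `2` of `A1`. -/
noncomputable def w1 (ν : R) : Fin 3 → R := col2 (A1 ν)
/-- Column `2` of `A2`. -/
noncomputable def w2 (ν : R) : Fin 3 → R := col2 (A2 ν)
/-- Column `2` of `A3`. -/
noncomputable def w3 (ν : R) : Fin 3 → R := col2 (A3 ν)

/-- The minors `μ₀ … μ₃` of `[w₀ | w₁ | w₂ | w₃]`. -/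
noncomputable def mu0 (ν : R) : R := (rows3 (w1 ν) (w2 ν) (w3 ν)).det
/-- Signed `3×3` minor of the window columns (Cramer eliminant), index `1`. -/
noncomputable def mu1 (ν : R) : R := -(rows3 w0 (w2 ν) (w3 ν)).det
/-- Signed `3×3` minor of the window columns (Cramer eliminant), index `2`. -/
noncomputable def mu2 (ν : R) : R := (rows3 w0 (w1 ν) (w3 ν)).det
/-- Signed `3×3` minor of the window columns (Cramer eliminant), index `3`; equals `−Dwin`. -/
noncomputable def mu3 (ν : R) : R := -(rows3 w0 (w1 ν) (w2 ν)).det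

/-- Cramer: `Σ_k μ_k · w_k = 0` (four vectors in `R³`). -/
theorem mu_rel (ν : R) : mu0 ν • (w0 : Fin 3 → R) + mu1 ν • w1 ν + mu2 ν • w2 ν + mu3 ν • w3 ν = 0 := by
  have h := cramer4 (w0 : Fin 3 → R) (w1 ν) (w2 ν) (w3 ν)
  simp only [mu0, mu1, mu2, mu3, neg_smul, ← sub_eq_add_neg]
  exact h

/-- `μ₃ = −D(ν)`: the top minor is minus the window determinant of `RecordRayWindow`. -/
theorem mu3_eq (ν : R) : mu3 ν = -Dwin ν := by
  rw [mu3, Dwin, ← Matrix.det_transpose (windowMat _ _)]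
  congr 2
  ext i j
  fin_cases i <;> fin_cases j <;> simp [rows3, w0, w1, w2, col2, A1, A2, windowMat]

/-- `det Ã(ν)·sB(ν)`, the denominator of the chain scalar `c = sA/(det Ã·sB)`. -/
noncomputable def dAsB (ν : R) : R := (prodA ν).det * sB ν

/-- The recurrence coefficients with the chain scalars cleared (integer polynomials in `ν`). -/
noncomputable def coef0 (ν : R) : R := mu0 ν * (sA ν * sA (ν + 1) * sA (ν + 2)) ^ 2
/-- Denominator-cleared recurrence coefficient `1` (generic ring). -/
noncomputable def coef1 (ν : R) : R := mu1 ν * dAsB ν ^ 2 * (sA (ν + 1) * sA (ν + 2)) ^ 2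
/-- Denominator-cleared recurrence coefficient `2` (generic ring). -/
noncomputable def coef2 (ν : R) : R := mu2 ν * (dAsB ν * dAsB (ν + 1)) ^ 2 * sA (ν + 2) ^ 2
/-- Denominator-cleared recurrence coefficient `3` (generic ring); a nonzero multiple of `Dwin`. -/
noncomputable def coef3 (ν : R) : R := mu3 ν * (dAsB ν * dAsB (ν + 1) * dAsB (ν + 2)) ^ 2

/-- The four coefficients as a family. -/
noncomputable def coefK (ν : R) : Fin 4 → R := ![coef0 ν, coef1 ν, coef2 ν, coef3 ν]

/-! Naturality: everything commutes with ring maps (it is all integer polynomials in `ν`). -/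

/-- Naturality of `A1` along a ring hom (`map`). -/
theorem map_A1 (ν : R) : f.mapMatrix (A1 ν) = A1 (f ν) := by rw [A1, A1, RingHom.map_adjugate, map_Pgen]

/-- Naturality of `A2` along a ring hom (`map`). -/
theorem map_A2 (ν : R) : f.mapMatrix (A2 ν) = A2 (f ν) := by
  rw [A2, A2, map_mul, RingHom.map_adjugate, RingHom.map_adjugate, map_Pgen, map_Pgen, map_add, map_one]

/-- Naturality of `A3` along a ring hom (`map`). -/
theorem map_A3 (ν : R) : f.mapMatrix (A3 ν) = A3 (f ν) := by
  rw [A3, A3, map_mul, map_mul, RingHom.map_adjugate, RingHom.map_adjugate, RingHom.map_adjugate, map_Pgen,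
    map_Pgen, map_Pgen, map_add, map_one, map_add, map_ofNat]

/-- Naturality of `w0` along a ring hom (`map`). -/
theorem map_w0 : f ∘ (w0 : Fin 3 → R) = (w0 : Fin 3 → S) := by rw [w0, w0, map_col2, map_one]
/-- Naturality of `w1` along a ring hom (`map`). -/
theorem map_w1 (ν : R) : f ∘ w1 ν = w1 (f ν) := by rw [w1, w1, map_col2, map_A1]
/-- Naturality of `w2` along a ring hom (`map`). -/
theorem map_w2 (ν : R) : f ∘ w2 ν = w2 (f ν) := by rw [w2, w2, map_col2, map_A2]
/-- Naturality of `w3` along a ring hom (`map`). -/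
theorem map_w3 (ν : R) : f ∘ w3 ν = w3 (f ν) := by rw [w3, w3, map_col2, map_A3]

/-- Naturality of `mu0` along a ring hom (`map`). -/
theorem map_mu0 (ν : R) : f (mu0 ν) = mu0 (f ν) := by rw [mu0, mu0, map_rows3_det, map_w1, map_w2, map_w3]
/-- Naturality of `mu1` along a ring hom (`map`). -/
theorem map_mu1 (ν : R) : f (mu1 ν) = mu1 (f ν) := by
  rw [mu1, mu1, map_neg, map_rows3_det, map_w0, map_w2, map_w3]
/-- Naturality of `mu2` along a ring hom (`map`). -/
theorem map_mu2 (ν : R) : f (mu2 ν) = mu2 (f ν) := by rw [mu2, mu2, map_rows3_det, map_w0, map_w1, map_w3]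
/-- Naturality of `mu3` along a ring hom (`map`). -/
theorem map_mu3 (ν : R) : f (mu3 ν) = mu3 (f ν) := by
  rw [mu3, mu3, map_neg, map_rows3_det, map_w0, map_w1, map_w2]

/-- Naturality of `dAsB` along a ring hom (`map`). -/
theorem map_dAsB (ν : R) : f (dAsB ν) = dAsB (f ν) := by rw [dAsB, dAsB, map_mul, map_prodA_det, map_sB]

/-- Naturality of `coefK` along a ring hom (`map`). -/
theorem map_coefK (ν : R) (k : Fin 4) : f (coefK ν k) = coefK (f ν) k := by
  fin_cases k <;>
    simp [coefK, coef0, coef1, coef2, coef3, map_mu0, map_mu1, map_mu2, map_mu3, map_dAsB, map_sA, map_ofNat]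

end Generic

/-! ### 2. The relation along the record ray (over `ℚ`) -/

/-- `det prodA · sB ≠ 0` for `ν ≥ 1`. -/
theorem dAsB_ne {m : ℕ} (hm : 0 < m) : dAsB (m : ℚ) ≠ 0 := mul_ne_zero (prodA_det_ne hm) (sB_ne hm)

/-- The connection scalar: `c_m · (det prodA · sB)(m) = sA(m)` (`m ≥ 1`). -/
theorem cRec_mul_dAsB {m : ℕ} (hm : 0 < m) : cRec m * dAsB (m : ℚ) = sA (m : ℚ) := by
  unfold cRec dAsB
  exact div_mul_cancel₀ _ (mul_ne_zero (prodA_det_ne hm) (sB_ne hm))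

/-- **The order-3 relation for a row of the adjugate frame**, `n ≥ 1`. -/
theorem adjugate_row_rel {n : ℕ} (hn : 1 ≤ n) (i : Fin 3) :
    coef0 (n : ℚ) * (frameMat (bC1 n)).adjugate i 2 +
      coef1 (n : ℚ) * (frameMat (bC1 (n + 1))).adjugate i 2 +
      coef2 (n : ℚ) * (frameMat (bC1 (n + 2))).adjugate i 2 +
      coef3 (n : ℚ) * (frameMat (bC1 (n + 3))).adjugate i 2 = 0 := by
  set u := (frameMat (bC1 n)).adjugate i with hu
  have s1 : (frameMat (bC1 (n + 1))).adjugate i = cRec n ^ 2 • Matrix.vecMul u (Pgen (n : ℚ)).adjugate :=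
    adjugate_row_of_step (frame_chain hn) i
  have s2 : (frameMat (bC1 (n + 2))).adjugate i =
      cRec (n + 1) ^ 2 • Matrix.vecMul ((frameMat (bC1 (n + 1))).adjugate i) (Pgen ((n : ℚ) + 1)).adjugate := by
    have h := adjugate_row_of_step (frame_chain (by omega : 1 ≤ n + 1)) i
    push_cast at h
    exact h
  have s3 : (frameMat (bC1 (n + 3))).adjugate i =
      cRec (n + 2) ^ 2 • Matrix.vecMul ((frameMat (bC1 (n + 2))).adjugate i) (Pgen ((n : ℚ) + 2)).adjugate := by
    have h := adjugate_row_of_step (frame_chain (by omega : 1 ≤ n + 2)) i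
    push_cast at h
    exact h
  have e1 : (frameMat (bC1 (n + 1))).adjugate i 2 = cRec n ^ 2 * (u ⬝ᵥ w1 (n : ℚ)) := by
    rw [s1]; rfl
  have e2 : (frameMat (bC1 (n + 2))).adjugate i 2 = cRec (n + 1) ^ 2 * cRec n ^ 2 * (u ⬝ᵥ w2 (n : ℚ)) := by
    rw [s2, s1, Matrix.smul_vecMul, Matrix.vecMul_vecMul, smul_smul]; rfl
  have e3 : (frameMat (bC1 (n + 3))).adjugate i 2 =
      cRec (n + 2) ^ 2 * cRec (n + 1) ^ 2 * cRec n ^ 2 * (u ⬝ᵥ w3 (n : ℚ)) := by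
    rw [s3, s2, s1, Matrix.smul_vecMul, Matrix.vecMul_vecMul, smul_smul, Matrix.smul_vecMul, Matrix.vecMul_vecMul,
      smul_smul, ← Matrix.mul_assoc]; rfl
  have hw0 : u 2 = u ⬝ᵥ (w0 : Fin 3 → ℚ) := by
    simp [w0, col2, dotProduct, Matrix.one_apply]
  have key : u ⬝ᵥ (mu0 (n : ℚ) • (w0 : Fin 3 → ℚ) + mu1 (n : ℚ) • w1 (n : ℚ) + mu2 (n : ℚ) • w2 (n : ℚ) +
      mu3 (n : ℚ) • w3 (n : ℚ)) = 0 := by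
    rw [mu_rel]; exact dotProduct_zero u
  rw [dotProduct_add, dotProduct_add, dotProduct_add, dotProduct_smul, dotProduct_smul, dotProduct_smul,
    dotProduct_smul] at key
  simp only [smul_eq_mul] at key
  have hc0 := cRec_mul_dAsB hn
  have hc1 : cRec (n + 1) * dAsB ((n : ℚ) + 1) = sA ((n : ℚ) + 1) := by
    have h := cRec_mul_dAsB (by omega : 0 < n + 1); push_cast at h; exact h
  have hc2 : cRec (n + 2) * dAsB ((n : ℚ) + 2) = sA ((n : ℚ) + 2) := by
    have h := cRec_mul_dAsB (by omega : 0 < n + 2); push_cast at h; exact h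
  rw [hw0, e1, e2, e3]
  unfold coef0 coef1 coef2 coef3
  linear_combination (sA (n : ℚ) * sA ((n : ℚ) + 1) * sA ((n : ℚ) + 2)) ^ 2 * key +
    mu1 (n : ℚ) * (sA ((n : ℚ) + 1) * sA ((n : ℚ) + 2)) ^ 2 * (u ⬝ᵥ w1 (n : ℚ)) *
        (cRec n * dAsB (n : ℚ) + sA (n : ℚ)) * hc0 +
    mu2 (n : ℚ) * sA ((n : ℚ) + 2) ^ 2 * (u ⬝ᵥ w2 (n : ℚ)) *
        (cRec n * dAsB (n : ℚ) * (cRec (n + 1) * dAsB ((n : ℚ) + 1)) + sA (n : ℚ) * sA ((n : ℚ) + 1)) *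
        (cRec (n + 1) * dAsB ((n : ℚ) + 1) * hc0 + sA (n : ℚ) * hc1) +
    mu3 (n : ℚ) * (u ⬝ᵥ w3 (n : ℚ)) *
        (cRec n * dAsB (n : ℚ) * (cRec (n + 1) * dAsB ((n : ℚ) + 1)) * (cRec (n + 2) * dAsB ((n : ℚ) + 2)) +
          sA (n : ℚ) * sA ((n : ℚ) + 1) * sA ((n : ℚ) + 2)) *
        (cRec (n + 1) * dAsB ((n : ℚ) + 1) * (cRec (n + 2) * dAsB ((n : ℚ) + 2)) * hc0 +
          sA (n : ℚ) * (cRec (n + 2) * dAsB ((n : ℚ) + 2)) * hc1 + sA (n : ℚ) * sA ((n : ℚ) + 1) * hc2)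

/-! ### 3. The polynomials and the Apéry-type statement -/

/-- The recursion coefficients `c_k = X · coef_k(X) ∈ ℚ[X]` (`X ↦ n`; the factor `X` makes the relation trivial at
`n = 0`, where the chain rule is not available). -/
noncomputable def cPoly (k : Fin 4) : ℚ[X] := X * coefK (X : ℚ[X]) k

/-- `cPoly k` evaluates to `n · coefK n k`. -/
theorem cPoly_eval (k : Fin 4) (n : ℕ) : (cPoly k).eval (n : ℚ) = n * coefK (n : ℚ) k := by
  rw [cPoly, eval_mul, eval_X, ← Polynomial.coe_evalRingHom, map_coefK, Polynomial.coe_evalRingHom, eval_X]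

/-- The top coefficient is a nonzero polynomial: its value at `n = 1` is `−D(1)·(…)² ≠ 0`. -/
theorem cPoly_three_ne : cPoly 3 ≠ 0 := by
  intro h
  have h1 : (cPoly 3).eval ((1 : ℕ) : ℚ) = 0 := by rw [h, eval_zero]
  rw [cPoly_eval] at h1
  have hD : Dwin ((1 : ℕ) : ℚ) ≠ 0 := Dwin_ne_of_mod (by simp)
  have d1 : dAsB ((1 : ℕ) : ℚ) ≠ 0 := dAsB_ne Nat.one_pos
  have d2 : dAsB (((1 : ℕ) : ℚ) + 1) ≠ 0 := by
    have h2 := dAsB_ne (m := 2) (by norm_num); norm_num at h2 ⊢; exact h2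
  have d3 : dAsB (((1 : ℕ) : ℚ) + 2) ≠ 0 := by
    have h3 := dAsB_ne (m := 3) (by norm_num); norm_num at h3 ⊢; exact h3
  have hc : coefK ((1 : ℕ) : ℚ) 3 ≠ 0 := by
    simp only [coefK, Fin.isValue, Matrix.cons_val]
    rw [coef3, mu3_eq]
    exact mul_ne_zero (neg_ne_zero.2 hD) (pow_ne_zero 2 (mul_ne_zero (mul_ne_zero d1 d2) d3))
  exact hc (by simpa using h1)

/-- The order-3 relation for row `i` of the adjugate frame, at EVERY `n` (trivial at `n = 0`). -/
theorem row_rel (i : Fin 3) (n : ℕ) :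
    ∑ k : Fin 4, (cPoly k).eval (n : ℚ) * (frameMat (bC1 (n + k))).adjugate i 2 = 0 := by
  rcases Nat.eq_zero_or_pos n with rfl | hn
  · simp [cPoly]
  · have h := adjugate_row_rel hn i
    simp only [Fin.sum_univ_four, cPoly_eval, coefK, Fin.isValue, Matrix.cons_val_zero, Matrix.cons_val_one,
      Matrix.cons_val, Fin.val_zero, Fin.val_one, Fin.val_two, add_zero,
      show ((3 : Fin 4) : ℕ) = 3 from rfl]
    linear_combination (n : ℚ) * h

/-- C1's `P_n` up to the unit `ρ_n`: `p̂_n = −adj(T(b_n))₀₂`. -/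
noncomputable def pHatC1 (n : ℕ) : ℚ := -(frameMat (bC1 n)).adjugate 0 2

/-- C1's `Q_n` up to the unit `ρ_n`: `q̂_n = adj(T(b_n))₂₂ = U(b)W(b′) − U(b′)W(b)`. -/
noncomputable def qHatC1 (n : ℕ) : ℚ := (frameMat (bC1 n)).adjugate 2 2

/-- Dictionary: `P_n = ρ_n · p̂_n` (all `n`). -/
theorem c1P_eq_pHatC1 (n : ℕ) : c1P n = rhoOf (aC1 n) * pHatC1 n := by
  rw [c1P_eq_adjugate, pHatC1, mul_neg]

/-- Dictionary: `Q_n = ρ_n · q̂_n` (`n ≥ 1`). -/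
theorem c1Q_eq_qHatC1 {n : ℕ} (hn : 1 ≤ n) : (c1Q n : ℚ) = rhoOf (aC1 n) * qHatC1 n :=
  c1Q_eq_adjugate hn

/-- **Clause (E).** The record pair `(p̂_n, q̂_n)` — `= (P_n, Q_n)/ρ_n` — is Apéry-type: one recurrence of order
`3` with coefficients in `ℚ[n]` and nonzero top coefficient annihilates both.  HONEST FRAMING: an algebraic
statement; nothing about `ζ(5)`. -/
theorem aperyType_c1 : IsAperyType pHatC1 qHatC1 := by
  refine ⟨3, cPoly, cPoly_three_ne, fun n => ?_, fun n => ?_⟩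
  · have h := row_rel 0 n
    simp only [pHatC1, mul_neg, Finset.sum_neg_distrib, neg_eq_zero]
    exact h
  · exact row_rel 2 n


/-! ### 4. Eventual forms: a nonzero polynomial in `n` vanishes only finitely often -/

/-- The top coefficient `c₃(n)` is nonzero for all large `n`: there the relation is a genuine order-3 recursion
`x_{n+3} = −(c₂(n)x_{n+2} + c₁(n)x_{n+1} + c₀(n)x_n)/c₃(n)` (the normal form of `Certificates.OrderThree`). -/
theorem cPoly_three_eval_eventually_ne : ∀ᶠ n : ℕ in atTop, (cPoly 3).eval (n : ℚ) ≠ 0 :=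
  eventually_eval_ne_zero cPoly_three_ne

end Summit.KontsevichZagierPeriods.Zeta5Search.RayC1.Generic
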